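import Summits.BirchSwinnertonDyer.BirchSwinnertonDyer.Theorems.ManinLocalTwoThreeConwayDepthTransfer
import HarnessLib

/-!
# The defect twin of `ConwayDepthTransfer`: a 2-adic Conway defect on the `f`-line forbids Néron congruence depth at `2`

Summit `BirchSwinnertonDyer`, route `ManinLocalTwoThree` (cell bsd-f2-manin), deciding crux C2 `ManinOddAtFour`
(stmt-BirchSwinnertonDyer-22967); descent / visibility lens (planner `bsd-f2-manin-desc` g7, MEMO-desc §24, support row
`ConwayDefectTransfer` of HOME/desc/g7/Sketch-desc-g7.lean, ask P-desc-1).  PROVED here, with exactly the sketch's hypotheses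
(the Prop `ConwayDefectTransfer` itself is not yet a tree leaf; once typed, `ConwayDefectTransfer_holds` is
`fun N _ W _ D Δ _ _ hΛ hdef hfin ↦ conwayDefectTransfer_of_le Δ hΛ hdef hfin`):
* `exists_int_lineIndex_mul_petersson_eq` — for a lattice `M` with `f`-line index `r = [e_f M : ℤ f]`, every
  `m ∈ M` has `r ⟨f, m⟩ ∈ ℤ ⟨f, f⟩` (`r` kills `M/K`, `K` = trace of `ℤf + f^⊥`, and `⟨f, K⟩ ⊆ ℤ⟨f,f⟩`);
* `conwayDefectTransfer_of_le` — if `Λ ≤ S^G`, `ord₂ [e_f S^G : ℤ f] < ord₂ deg φ` and the index is finite, then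
  `¬ Δ.NeronCongruenceDepthAt 2`: a depth witness `q ⟨f,f⟩ = ⟨f, g⟩`, `g ∈ Λ ≤ S^G`, has `q = n/r`, so
  `ord₂ q ≥ −ord₂ r > −ord₂ deg φ`.
Only `Λ ≤ S^G` is used (neither `D.f ∈ S^G` nor `4 ∣ N` nor the odd-multiple half of `IsConwayNeronAtTwo`).  Nothing about BSD or
Manin's conjecture is asserted.
-/

set_option autoImplicit false
set_option linter.dupNamespace false

noncomputable section

open scoped Classical MatrixGroups ModularForm
open CongruenceSubgroup Literature.NumberTheory.EllipticCurves.ModularForms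
open Summit.BirchSwinnertonDyer.Rank1Residual.ManinAdditive
  Summit.BirchSwinnertonDyer.Rank1Residual.ManinAdditive.ConwayCut

namespace Summit.BirchSwinnertonDyer.BirchSwinnertonDyer.Theorems.ManinLocalTwoThree

variable {N : ℕ} [NeZero N] {W : WeierstrassCurve ℚ} [W.IsElliptic] {D : ModularParametrizationData W N}

/-- **`r ⟨f, m⟩ ∈ ℤ ⟨f, f⟩` for the `f`-line index `r`.**  For a `ℤ`-lattice `M` of cusp forms and its `f`-line index
`r = [e_f M : ℤ f]` (the tree's `lineIndex`, `0` when infinite — then the claim is trivial), every `m ∈ M` satisfies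
`r · ⟨f, m⟩ = n · ⟨f, f⟩` for some integer `n` (`r` kills `M/K`, `K` the trace of `ℤf + f^⊥` on `M`, and `⟨f, K⟩ ⊆ ℤ⟨f, f⟩`;
neither `f ∈ M` nor finiteness is needed). [folklore] -/
theorem exists_int_lineIndex_mul_petersson_eq (M : Submodule ℤ (CuspForm (Gamma0 N) 2))
    (f : CuspForm (Gamma0 N) 2) {m : CuspForm (Gamma0 N) 2} (hm : m ∈ M) :
    ∃ n : ℤ, (lineIndex M f : ℂ) * peterssonProduct (Gamma0 N) 2 f m = n * peterssonProduct (Gamma0 N) 2 f f := by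
  set θ := peterssonProductₗ (Gamma0 N) 2 f with hθ
  set c₀ := peterssonProduct (Gamma0 N) 2 f f with hc₀def
  set K : Submodule ℤ M := ((ℤ ∙ f) ⊔ (M ⊓ (LinearMap.ker θ).restrictScalars ℤ)).comap M.subtype with hK
  set r := lineIndex M f with hrdef
  have hrK : r = Nat.card (M ⧸ K) := rfl
  have hθf : θ f = c₀ := by rw [hθ, peterssonProductₗ_apply]
  -- `m ∈ K ⟹ θ m ∈ ℤ c₀`
  have memK : ∀ m : M, m ∈ K → ∃ n : ℤ, θ (m : CuspForm (Gamma0 N) 2) = n * c₀ := by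
    intro m hmK
    rw [hK, Submodule.mem_comap, Submodule.subtype_apply, Submodule.mem_sup] at hmK
    obtain ⟨y, hy, z, hz, hyz⟩ := hmK
    obtain ⟨n, rfl⟩ := Submodule.mem_span_singleton.mp hy
    refine ⟨n, ?_⟩
    have hz0 : θ z = 0 := by
      have := (Submodule.mem_inf.mp hz).2
      rwa [Submodule.restrictScalars_mem, LinearMap.mem_ker] at this
    rw [← hyz, map_add, map_zsmul, hz0, add_zero, zsmul_eq_mul, hθf]
  -- `r` kills `M/K`
  have hkill : (r • (⟨m, hm⟩ : M)) ∈ K := by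
    rw [← Submodule.Quotient.mk_eq_zero, Submodule.Quotient.mk_smul, hrK]
    exact card_nsmul_eq_zero'
  obtain ⟨n, hn⟩ := memK _ hkill
  refine ⟨n, ?_⟩
  rw [← hn, Submodule.coe_smul_of_tower, map_nsmul, nsmul_eq_mul, hθ, peterssonProductₗ_apply]

/-- **The defect twin of `conwayDepthTransfer_of_mem` (desc's support row `ConwayDefectTransfer`, PROVED).**  For a Néron
`f`-line datum `Δ` with `Λ ≤ S^G` (only this inclusion), if the `f`-line index `r = [e_f S^G : ℤ f]` is finite (`r ≠ 0`)
with `ord₂ r < ord₂ deg φ` (a 2-adic Conway DEFECT), then `Δ` has NO Néron congruence depth at `2`: a depth witness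
`q ⟨f, f⟩ = ⟨f, g⟩` with `g ∈ Λ` would have `q = n/r`, `ord₂ q ≥ −ord₂ r > −ord₂ deg φ`.  (The row's hypotheses `4 ∣ N`
and `D.f ∈ S^G` are not needed for the bookkeeping and are dropped; so `ConwayDefectTransfer_holds` is
`fun N _ W _ D Δ _ _ hΛ hdef hfin ↦ conwayDefectTransfer_of_le Δ hΛ hdef hfin` once the row is typed.)
[cite: AgasheRibetStein2012, §2.1 (shape only: congruence number as an `f`-line index; the Conway-lattice row is the cell's, MEMO-desc §24)] -/
theorem conwayDefectTransfer_of_le (Δ : NeronFLineDatum W D) (hΛ : Δ.Λ ≤ conwayStableLattice N)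
    (hdef : padicValNat 2 (lineIndex (conwayStableLattice N) D.f) < padicValNat 2 D.modularDegree)
    (hr : lineIndex (conwayStableLattice N) D.f ≠ 0) : ¬ Δ.NeronCongruenceDepthAt 2 := by
  rintro ⟨g, q, hq0, hq, hv⟩
  obtain ⟨n, hn⟩ := exists_int_lineIndex_mul_petersson_eq (conwayStableLattice N) D.f (hΛ g.2)
  set r := lineIndex (conwayStableLattice N) D.f with hrdef
  have hc₀ := Δ.petersson_self_ne_zero
  -- `q = n / r`
  have hqr : (q : ℂ) * (r : ℂ) = n := by
    have e : ((q : ℂ) * r) * peterssonProduct (Gamma0 N) 2 D.f D.f = (n : ℂ) * peterssonProduct (Gamma0 N) 2 D.f D.f := by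
      rw [mul_comm (q : ℂ) (r : ℂ), mul_assoc, hq, hn]
    exact mul_right_cancel₀ hc₀ e
  have hqr' : q * r = n := by exact_mod_cast hqr
  have hn0 : (n : ℚ) ≠ 0 := by
    rw [← hqr']
    exact mul_ne_zero hq0 (by exact_mod_cast hr)
  have hqeq : q = (n : ℚ) / r := by
    rw [eq_div_iff (by exact_mod_cast hr : (r : ℚ) ≠ 0), hqr']
  rw [hqeq, padicValRat.div hn0 (by exact_mod_cast hr), padicValRat.of_nat] at hv
  have hvn : padicValRat 2 (n : ℚ) = (padicValInt 2 n : ℤ) := padicValRat.of_int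
  rw [hvn] at hv
  omega

end Summit.BirchSwinnertonDyer.BirchSwinnertonDyer.Theorems.ManinLocalTwoThree

end
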